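import Literature.MathematicalPhysics.QuantumFieldTheory.Balaban1983to89.T4TrajectoryDensity

/-!
# `Balaban1983to89.B16Ineq175Tilted` — [Balaban1989LargeFieldII] (1.73)–(1.75) p. 380 WITH A SOURCE-TILTED OBSERVABLE
# ATTACHED: the normalised complex-weight expectation `h ↦ (∫ρ₀e^{σ+tW})⁻¹ ∫ρ₀e^{σ+tW}•h`, its (1.75)-bound on the tilt disc
# `s + |t|·B ≤ 1`, its complex t-DERIVATIVE = the complex-weight covariance, the covariance bound `2·B·e^{6(s+|t|B)}·m`,
# and the first-order size of the dressing `‖E_t h − E_0 h‖ ≤ 2·B·e^{6(s+|t|B)}·m·|t|`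

CITATION HEADER (lean-in-tree rule 2026-08-18).  Source: T. Bałaban, *Large field renormalization. II. Localization,
exponentiation, and bounds for the 𝐑 operation*, Commun. Math. Phys. **122**, 355–392 (1989), doi:10.1007/bf01238433
[Balaban1989LargeFieldII] (cell paper B16; held: `paper:balaban1989-cmp122-large-field-ii`; journal page = PDF page + 354).
WHAT IS PRINTED (pp. 379–380 [25–26], text layer re-read by this seat): *"Thus the operation 𝐓′_k(X) can be represented as the
operation for a regular G-valued configuration U, with the additional small, and possible complex valued, term in the
exponential. All the expressions in the definition (1.71), for the configuration U, are real, and the exponential density in the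
integral is positive. This implies the inequalities |𝐓′_k(X,(𝐔,𝐉))F| = |𝐓′_k(X,(U,0))e^{σ}F| ≤ 𝐓′_k(X,(U,0))|e^{σ}F| ≤
(𝐓′_k(X,(U,0))1) sup e^{|σ|}|F|, (1.73)  |𝐓′_k(X,(𝐔,𝐉))1| = |𝐓′_k(X,(U,0))e^{σ}| ≥ 𝐓′_k(X,(U,0))e^{−2|σ|} ≥
(𝐓′_k(X,(U,0))1)e^{−2sup|σ|}, (1.74) where σ is the small term of the first order in A′, 𝐉, and F is a function of the
integration variables in the integral (1.71). The expression 𝐓′_k(X,(U,0))1 is obviously positive, although it may be very small,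
hence 𝐓′_k(X,(𝐔,𝐉))1 ≠ 0, and from the above inequalities we obtain |(𝐓′_k(X,(𝐔,𝐉))1)⁻¹𝐓′_k(X,(𝐔,𝐉))F| ≤ e^{3sup|σ|}sup|F|.
(1.75)"*; and p. 356 [2] ll. 1–6: the analysis of *"expectation values of physical observables, like loop variables"* is
DEFERRED (*"deserve detailed analysis and further publication"*) — the printed sequel with observables attached is T. Bałaban,
CMP **198** (1998) 493 ∕ T. Bałaban, M. O'Carroll, CMP **199** (1999) 493, NOT HELD (acq-04355 ∕ acq-04013, cite-only).

WHY THIS FILE (HUMAN RULING D-0062, Track A full width; DAG node N14 = NE1′ «dressed stability, observable-attached,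
μ-uniform — NOT PRINTED»; seat dag-n14-b, -b FIRST-MISSING-ESTIMATE; lit-balaban desk answer [DESK-ANSWER N14] 2026-08-25
21:40Z to the ask «MISSING ESTIMATE N14: (1.71)–(1.75) with observable attachment»).  At the printed locator nothing displayed
is missing from the tree: (1.73)–(1.75) are proved on the finite positive-functional model (`B16.ineq173`∕`ineq174`∕`ineq175`)
AND at measure level for a complex density `ρ₀·e^{σ}` and a Banach-valued integrand (`T4TrajectoryDensity.norm_integral_weight_smul_le`,
`mul_exp_le_re_integral_weight`, `integral_weight_ne_zero`, `norm_ratio_le`).  ATTACHING AN OBSERVABLE `W` (a bounded function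
of the integration variables, `‖W‖ ≤ B`: the unit-lattice loop variable pulled back through the averagings) WITH A COMPLEX
SOURCE `t` replaces `σ` by `σ + t·W`; the desk's SIGNATURE STUB (`lit-balaban-lead/desk/N14TiltedStub.lean`, sha256
9db4ab3d48de4053…, rc 0) typed the resulting objects and two `Prop`s, which this module RESTATES BY NAME (same bodies) and
INHABITS:
* §1 `tiltWeight ρ₀ σ W t = weight ρ₀ (σ + t·W)`, `tiltedMean μ ρ₀ σ W h t = (∫tiltWeight)⁻¹ • ∫tiltWeight • h` (print's
  `(𝐓′_k(X,(𝐔,𝐉))e^{tW})⁻¹ 𝐓′_k(X,(𝐔,𝐉))(e^{tW}F)` in the integrated currency of `norm_ratio_le`), `tiltedCov` = the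
  complex-weight covariance `E_t(W•h) − E_t(W)•E_t(h)`; the pointwise size of the tilt `‖σ + tW‖ ≤ s + |t|B`.
* §2 (1.73)ₜ ∕ (1.74)ₜ ∕ (1.75)ₜ — SUBSTITUTION instances of the tree's measure-level theorems at `σ ↦ σ + tW`,
  `s ↦ s + |t|B`: `norm_integral_tiltWeight_smul_le`, `mul_exp_le_re_integral_tiltWeight`, `integral_tiltWeight_ne_zero`,
  `norm_tiltedMean_le`; the desk's `TiltedRatioBound` INHABITED (`tiltedRatioBound`).  The smallness `s + |t|B ≤ 1` is
  load-bearing exactly as `sup|σ| ≤ 1` is in (1.74) (`T4TrajectoryDensity.ineq174_needs_smallness`).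
* §3 THE FIRST NON-SUBSTITUTION ESTIMATE (folklore calculus): `t ↦ ∫tiltWeight•h` and `t ↦ ∫tiltWeight` are
  complex-differentiable at EVERY `t` with derivatives `∫tiltWeight•(W•h)`, `∫tiltWeight·W` (dominated differentiation under
  the integral, Mathlib `hasDerivAt_integral_of_dominated_loc_of_deriv_le`, majorant `|ρ₀|·e^{s+(|t|+1)B}·B·m` on the unit ball
  about `t`); on the tilt disc `s + |t|B ≤ 1` (denominator ≠ 0 by (1.74)ₜ) the normalised expectation has derivative THE
  COVARIANCE (`hasDerivAt_tiltedMean`, quotient rule) and `‖tiltedCov‖ ≤ 2·B·e^{6(s+|t|B)}·m` (`norm_tiltedCov_le`, from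
  (1.75)ₜ applied to `W•h`, `W`, `h`); the desk's `TiltedCovarianceBound` INHABITED (`tiltedCovarianceBound`).
* §4 FIRST-ORDER SIZE OF THE DRESSING (folklore calculus): on the disc the dressed normalised expectation moves from the
  undressed one by at most `2·B·e^{6(s+|t|B)}·m·|t|` (`norm_tiltedMean_sub_tiltedMean_zero_le`, mean value inequality on the
  closed ball of radius `|t|`), and is `DifferentiableOn ℂ` the open disc (`differentiableOn_tiltedMean`).

HONEST FRAMING.  (1.73)–(1.75) are printed for the ACTION's representation only; the tilted objects are NOT PRINTED in
[B16]; every declaration below is either a definition restating the desk stub, a substitution instance of a tree theorem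
(cited to the printed display it instantiates), or folklore calculus (parametric differentiation, quotient rule, mean value
inequality).  Nothing is asserted about Bałaban's densities: `μ`, `ρ₀`, `σ`, `W`, `h` are arbitrary data satisfying the displayed
hypotheses; whether the genuine 𝐓′_k(X,(𝐔,𝐉)) with the loop observable attached satisfies them is the node's object-level
question (NODE O; cell `pub-balaban-gaps` row NE1′: WORK-bound as mathematics, OBJECT-bound in Lean).  Not a discharge of N14;
typed 28∕28 · discharged count unmoved; nothing continuum ∕ ℝ⁴ ∕ OS ∕ mass-gap ∕ Clay.  0 sorry, axioms standard.  No existing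
module is modified; `CompleteSpace F` is never needed.
-/

noncomputable section

namespace Literature.MathematicalPhysics.QuantumFieldTheory.Balaban1983to89.B16Ineq175Tilted

open _root_.MeasureTheory _root_.Filter _root_.Metric _root_.Set
open scoped _root_.Topology
open Literature.MathematicalPhysics.QuantumFieldTheory.Balaban1983to89.T4TrajectoryDensity

variable {Z : Type*} {F : Type*} [NormedAddCommGroup F] [NormedSpace ℂ F]

/-! ## §1 The tilted weight, the tilted normalised expectation, the covariance (desk stub, restated BY NAME) -/

/-- **The t-tilted complex weight** `ρ₀·e^{σ + tW}` — the weight of (1.73) p. 380 (`T4TrajectoryDensity.weight ρ₀ σ` = the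
positive density of the real regular configuration times *"the additional small, and possible complex valued, term in the
exponential"*) with an observable `W` attached through a complex source `t` (desk stub `N14TiltedStub.tiltWeight`, same body).
[folklore] -/
def tiltWeight (ρ₀ : Z → ℝ) (σ W : Z → ℂ) (t : ℂ) : Z → ℂ :=
  weight ρ₀ (fun z => σ z + t * W z)

/-- **The tilted normalised complex-weight expectation** `h ↦ (∫ρ₀e^{σ+tW}dμ)⁻¹ • ∫ρ₀e^{σ+tW}•h dμ` — print's
`(𝐓′_k(X,(𝐔,𝐉))1)^{−1}𝐓′_k(X,(𝐔,𝐉))F` of (1.75) with `e^{tW}` inside both integrals, in the integrated currency of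
`T4TrajectoryDensity.norm_ratio_le` (desk stub `N14TiltedStub.tiltedMean`, same body; junk value: a vanishing denominator has
inverse `0`). [folklore] -/
def tiltedMean [MeasurableSpace Z] (μ : Measure Z) (ρ₀ : Z → ℝ) (σ W : Z → ℂ) (h : Z → F) (t : ℂ) : F :=
  (∫ z, tiltWeight ρ₀ σ W t z ∂μ)⁻¹ • ∫ z, tiltWeight ρ₀ σ W t z • h z ∂μ

/-- **The complex-weight covariance** of `W` and `h` under the tilted normalised expectation: `E_t(W•h) − E_t(W)•E_t(h)`
(desk stub `N14TiltedStub.tiltedCov`, same body; `E_t(W)` is the scalar instance `F = ℂ`). [folklore] -/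
def tiltedCov [MeasurableSpace Z] (μ : Measure Z) (ρ₀ : Z → ℝ) (σ W : Z → ℂ) (h : Z → F) (t : ℂ) : F :=
  tiltedMean μ ρ₀ σ W (fun z => W z • h z) t - (tiltedMean μ ρ₀ σ W W t) • tiltedMean μ ρ₀ σ W h t

/-- Unfolding the tilted weight: `tiltWeight ρ₀ σ W t z = ρ₀(z)·e^{σ(z) + t·W(z)}`. [cite: Balaban1989LargeFieldII, (1.73) p.380] -/
theorem tiltWeight_apply (ρ₀ : Z → ℝ) (σ W : Z → ℂ) (t : ℂ) (z : Z) :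
    tiltWeight ρ₀ σ W t z = (ρ₀ z : ℂ) * Complex.exp (σ z + t * W z) := rfl

/-- At zero source the tilted weight is the untilted weight of (1.73). [cite: Balaban1989LargeFieldII, (1.73) p.380] -/
theorem tiltWeight_zero (ρ₀ : Z → ℝ) (σ W : Z → ℂ) : tiltWeight ρ₀ σ W 0 = weight ρ₀ σ := by
  funext z
  simp [tiltWeight, weight_apply]

/-- The pointwise size of the tilted exponent: `‖σ + tW‖ ≤ s + |t|·B` from `‖σ‖ ≤ s`, `‖W‖ ≤ B`. [folklore] -/
private theorem norm_add_mul_le {σ W : Z → ℂ} {s B : ℝ} {t : ℂ} {z : Z} (hσ : ‖σ z‖ ≤ s) (hW : ‖W z‖ ≤ B) :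
    ‖σ z + t * W z‖ ≤ s + ‖t‖ * B :=
  (norm_add_le _ _).trans (add_le_add hσ (by rw [norm_mul]; exact mul_le_mul_of_nonneg_left hW (norm_nonneg _)))

/-- The quotient-rule algebra behind `tiltedCov = d/dt tiltedMean`: with `D = ∫w`, `D′ = ∫w·W`, `N = ∫w•h`, `N′ = ∫w•(W•h)`,
`D⁻¹•N′ − (D⁻¹D′)•(D⁻¹•N) = D⁻¹•N′ + (−D′/D²)•N`. [folklore] -/
private theorem cov_algebra (D D' : ℂ) (N N' : F) :
    D⁻¹ • N' - (D⁻¹ * D') • (D⁻¹ • N) = D⁻¹ • N' + (-D' / D ^ 2) • N := by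
  have hs : -(D⁻¹ * D' * D⁻¹) = -D' / D ^ 2 := by
    rw [neg_div, div_eq_mul_inv, ← inv_pow, sq]; ring
  rw [smul_smul, sub_eq_add_neg, ← neg_smul, hs]

/-- The pointwise derivative of the tilted integrand in the source: `d/dt (ρ₀e^{σ+tW}•h) = ρ₀e^{σ+tW}•(W•h)`. [folklore] -/
private theorem hasDerivAt_tiltWeight_smul (ρ₀ : Z → ℝ) (σ W : Z → ℂ) (h : Z → F) (z : Z) (t : ℂ) :
    HasDerivAt (fun τ : ℂ => tiltWeight ρ₀ σ W τ z • h z) (tiltWeight ρ₀ σ W t z • (W z • h z)) t := by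
  have h1 : HasDerivAt (fun τ : ℂ => σ z + τ * W z) (1 * W z) t :=
    ((hasDerivAt_id t).mul_const (W z)).const_add (σ z)
  have h2 : HasDerivAt (fun τ : ℂ => (ρ₀ z : ℂ) * Complex.exp (σ z + τ * W z))
      ((ρ₀ z : ℂ) * (Complex.exp (σ z + t * W z) * (1 * W z))) t := h1.cexp.const_mul _
  have h3 := h2.smul_const (h z)
  have e : (ρ₀ z : ℂ) * (Complex.exp (σ z + t * W z) * (1 * W z)) =
      (ρ₀ z : ℂ) * Complex.exp (σ z + t * W z) * W z := by ring
  rw [e] at h3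
  simpa only [tiltWeight_apply, smul_smul] using h3

variable [MeasurableSpace Z] {μ : Measure Z} {ρ₀ : Z → ℝ} {σ W : Z → ℂ} {s B m : ℝ} {h : Z → F}

/-- The tilted exponent is bounded by `s + |t|B` almost everywhere. [folklore] -/
private theorem ae_norm_tilt_le (hσ : ∀ᵐ z ∂μ, ‖σ z‖ ≤ s) (hW : ∀ᵐ z ∂μ, ‖W z‖ ≤ B) (t : ℂ) :
    ∀ᵐ z ∂μ, ‖σ z + t * W z‖ ≤ s + ‖t‖ * B := by
  filter_upwards [hσ, hW] with z hz hWz using norm_add_mul_le hz hWz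

/-- The tilted exponent is a.e.-strongly measurable. [folklore] -/
private theorem aestronglyMeasurable_tilt (hσm : AEStronglyMeasurable σ μ) (hWm : AEStronglyMeasurable W μ) (t : ℂ) :
    AEStronglyMeasurable (fun z => σ z + t * W z) μ :=
  hσm.add (hWm.const_mul t)

/-- The tilted weight is a.e.-strongly measurable. [cite: Balaban1989LargeFieldII, (1.73) p.380] -/
theorem aestronglyMeasurable_tiltWeight (hρ : AEStronglyMeasurable ρ₀ μ) (hσm : AEStronglyMeasurable σ μ)
    (hWm : AEStronglyMeasurable W μ) (t : ℂ) : AEStronglyMeasurable (tiltWeight ρ₀ σ W t) μ :=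
  aestronglyMeasurable_weight hρ (aestronglyMeasurable_tilt hσm hWm t)

/-- The tilted weight is integrable (`ρ₀` integrable, `σ`, `W` essentially bounded). [cite: Balaban1989LargeFieldII, (1.73) p.380] -/
theorem integrable_tiltWeight (hρ : Integrable ρ₀ μ) (hσm : AEStronglyMeasurable σ μ) (hWm : AEStronglyMeasurable W μ)
    (hσ : ∀ᵐ z ∂μ, ‖σ z‖ ≤ s) (hW : ∀ᵐ z ∂μ, ‖W z‖ ≤ B) (t : ℂ) : Integrable (tiltWeight ρ₀ σ W t) μ :=
  integrable_weight hρ (aestronglyMeasurable_tilt hσm hWm t) (ae_norm_tilt_le hσ hW t)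

/-- The tilted weight times an essentially bounded integrand is integrable. [cite: Balaban1989LargeFieldII, (1.73) p.380] -/
theorem integrable_tiltWeight_smul (hρ : Integrable ρ₀ μ) (hσm : AEStronglyMeasurable σ μ)
    (hWm : AEStronglyMeasurable W μ) (hσ : ∀ᵐ z ∂μ, ‖σ z‖ ≤ s) (hW : ∀ᵐ z ∂μ, ‖W z‖ ≤ B)
    (hhm : AEStronglyMeasurable h μ) (hh : ∀ᵐ z ∂μ, ‖h z‖ ≤ m) (t : ℂ) :
    Integrable (fun z => tiltWeight ρ₀ σ W t z • h z) μ :=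
  integrable_weight_smul hρ (aestronglyMeasurable_tilt hσm hWm t) (ae_norm_tilt_le hσ hW t) hhm hh

/-- The attached factor `W•h` is essentially bounded by `B·m`. [folklore] -/
private theorem ae_norm_smul_le (hW : ∀ᵐ z ∂μ, ‖W z‖ ≤ B) (hh : ∀ᵐ z ∂μ, ‖h z‖ ≤ m) :
    ∀ᵐ z ∂μ, ‖W z • h z‖ ≤ B * m := by
  filter_upwards [hW, hh] with z hWz hhz
  rw [norm_smul]
  exact mul_le_mul hWz hhz (norm_nonneg _) ((norm_nonneg _).trans hWz)

/-- A positive base mass forces `μ ≠ 0`, so an a.e. norm bound is witnessed somewhere: its constant is nonnegative (this is how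
`0 ≤ s`, `0 ≤ B` follow from the displayed hypotheses). [folklore] -/
private theorem nonneg_of_ae_norm_le {g : Z → ℂ} {c : ℝ} (hP : 0 < ∫ z, ρ₀ z ∂μ) (hg : ∀ᵐ z ∂μ, ‖g z‖ ≤ c) : 0 ≤ c := by
  have hμ : μ ≠ 0 := by
    intro h0; rw [h0, integral_zero_measure] at hP; exact lt_irrefl _ hP
  haveI : (ae μ).NeBot := ae_neBot.mpr hμ
  obtain ⟨z, hz⟩ := hg.exists
  exact (norm_nonneg _).trans hz

/-! ## §2 (1.73)ₜ, (1.74)ₜ, (1.75)ₜ: the printed inequalities at `σ ↦ σ + tW` -/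

/-- **(1.73)ₜ** — (1.73) p. 380 at the tilted exponent: `‖∫ρ₀e^{σ+tW}•h dμ‖ ≤ (∫ρ₀)·e^{s+|t|B}·m`
(substitution instance of `T4TrajectoryDensity.norm_integral_weight_smul_le`). [cite: Balaban1989LargeFieldII, (1.73) p.380] -/
theorem norm_integral_tiltWeight_smul_le (hρ : Integrable ρ₀ μ) (hρ0 : 0 ≤ᵐ[μ] ρ₀) (hσ : ∀ᵐ z ∂μ, ‖σ z‖ ≤ s)
    (hW : ∀ᵐ z ∂μ, ‖W z‖ ≤ B) (hh : ∀ᵐ z ∂μ, ‖h z‖ ≤ m) (t : ℂ) :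
    ‖∫ z, tiltWeight ρ₀ σ W t z • h z ∂μ‖ ≤ (∫ z, ρ₀ z ∂μ) * Real.exp (s + ‖t‖ * B) * m :=
  norm_integral_weight_smul_le hρ hρ0 (ae_norm_tilt_le hσ hW t) hh

/-- **(1.74)ₜ** — (1.74) p. 380 at the tilted exponent: `(∫ρ₀)·e^{−2(s+|t|B)} ≤ Re ∫ρ₀e^{σ+tW}dμ` on the tilt disc
`s + |t|B ≤ 1` (substitution instance of `T4TrajectoryDensity.mul_exp_le_re_integral_weight`; the smallness is load-bearing as
in print). [cite: Balaban1989LargeFieldII, (1.74) p.380] -/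
theorem mul_exp_le_re_integral_tiltWeight (hρ : Integrable ρ₀ μ) (hρ0 : 0 ≤ᵐ[μ] ρ₀) (hσm : AEStronglyMeasurable σ μ)
    (hWm : AEStronglyMeasurable W μ) (hσ : ∀ᵐ z ∂μ, ‖σ z‖ ≤ s) (hW : ∀ᵐ z ∂μ, ‖W z‖ ≤ B) {t : ℂ}
    (ht : s + ‖t‖ * B ≤ 1) :
    (∫ z, ρ₀ z ∂μ) * Real.exp (-(2 * (s + ‖t‖ * B))) ≤ (∫ z, tiltWeight ρ₀ σ W t z ∂μ).re :=
  mul_exp_le_re_integral_weight hρ hρ0 (aestronglyMeasurable_tilt hσm hWm t) (ae_norm_tilt_le hσ hW t) ht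

/-- (1.74)ₜ, the consequence print draws: on the tilt disc the tilted normalisation `∫ρ₀e^{σ+tW}dμ` does not vanish, GIVEN a
positive base mass (*"obviously positive, although it may be very small, hence 𝐓′_k(X,(𝐔,𝐉))1 ≠ 0"*).
[cite: Balaban1989LargeFieldII, (1.74) p.380] -/
theorem integral_tiltWeight_ne_zero (hρ : Integrable ρ₀ μ) (hρ0 : 0 ≤ᵐ[μ] ρ₀) (hσm : AEStronglyMeasurable σ μ)
    (hWm : AEStronglyMeasurable W μ) (hσ : ∀ᵐ z ∂μ, ‖σ z‖ ≤ s) (hW : ∀ᵐ z ∂μ, ‖W z‖ ≤ B) {t : ℂ}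
    (ht : s + ‖t‖ * B ≤ 1) (hP : 0 < ∫ z, ρ₀ z ∂μ) : (∫ z, tiltWeight ρ₀ σ W t z ∂μ) ≠ 0 :=
  integral_weight_ne_zero hρ hρ0 (aestronglyMeasurable_tilt hσm hWm t) (ae_norm_tilt_le hσ hW t) ht hP

/-- **(1.75)ₜ** — (1.75) p. 380 at the tilted exponent: `‖tiltedMean h t‖ ≤ e^{3(s+|t|B)}·m` on the tilt disc (substitution
instance of `T4TrajectoryDensity.norm_ratio_le`). [cite: Balaban1989LargeFieldII, (1.75) p.380] -/
theorem norm_tiltedMean_le (hρ : Integrable ρ₀ μ) (hρ0 : 0 ≤ᵐ[μ] ρ₀) (hP : 0 < ∫ z, ρ₀ z ∂μ)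
    (hσm : AEStronglyMeasurable σ μ) (hWm : AEStronglyMeasurable W μ) (hσ : ∀ᵐ z ∂μ, ‖σ z‖ ≤ s)
    (hW : ∀ᵐ z ∂μ, ‖W z‖ ≤ B) (hh : ∀ᵐ z ∂μ, ‖h z‖ ≤ m) (hm : 0 ≤ m) {t : ℂ} (ht : s + ‖t‖ * B ≤ 1) :
    ‖tiltedMean μ ρ₀ σ W h t‖ ≤ Real.exp (3 * (s + ‖t‖ * B)) * m :=
  norm_ratio_le hρ hρ0 hP (aestronglyMeasurable_tilt hσm hWm t) (ae_norm_tilt_le hσ hW t) ht hh hm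

/-- **THE DESK STUB'S `TiltedRatioBound`**, restated BY NAME with the same body (desk file `N14TiltedStub.lean`): for a
nonnegative integrable density of positive mass, `‖σ‖ ≤ s`, `‖W‖ ≤ B`, `‖h‖ ≤ m` a.e. and the load-bearing smallness
`s + |t|·B ≤ 1`: `‖tiltedMean h t‖ ≤ e^{3(s+|t|B)}·m` (the t-tilted instance of the cited (1.75); the tilted form is NOT PRINTED). [cite: Balaban1989LargeFieldII, (1.75) p.380] -/
def TiltedRatioBound (μ : Measure Z) (ρ₀ : Z → ℝ) (σ W : Z → ℂ) (s B : ℝ) : Prop :=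
  Integrable ρ₀ μ → 0 ≤ᵐ[μ] ρ₀ → 0 < ∫ z, ρ₀ z ∂μ → AEStronglyMeasurable σ μ → AEStronglyMeasurable W μ →
  (∀ᵐ z ∂μ, ‖σ z‖ ≤ s) → (∀ᵐ z ∂μ, ‖W z‖ ≤ B) →
  ∀ (h : Z → F) (m : ℝ) (t : ℂ), 0 ≤ m → AEStronglyMeasurable h μ → (∀ᵐ z ∂μ, ‖h z‖ ≤ m) →
    s + ‖t‖ * B ≤ 1 → ‖tiltedMean μ ρ₀ σ W h t‖ ≤ Real.exp (3 * (s + ‖t‖ * B)) * m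

/-- **`TiltedRatioBound` INHABITED** for every datum — it is (1.75)ₜ (`norm_tiltedMean_le`).
[cite: Balaban1989LargeFieldII, (1.75) p.380] -/
theorem tiltedRatioBound (μ : Measure Z) (ρ₀ : Z → ℝ) (σ W : Z → ℂ) (s B : ℝ) :
    TiltedRatioBound (F := F) μ ρ₀ σ W s B :=
  fun hρ hρ0 hP hσm hWm hσ hW _h _m _t hm _ hh ht => norm_tiltedMean_le hρ hρ0 hP hσm hWm hσ hW hh hm ht

/-! ## §3 The complex t-derivative: differentiation under the integral, the quotient rule, the covariance bound -/


/-- **Differentiation under the integral**: for EVERY source `t`, `τ ↦ ∫ρ₀e^{σ+τW}•h dμ` has complex derivative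
`∫ρ₀e^{σ+tW}•(W•h) dμ` at `t` (Mathlib `hasDerivAt_integral_of_dominated_loc_of_deriv_le` on the unit ball about `t`, majorant
`|ρ₀|·e^{s+(|t|+1)B}·B·m`). No disc condition: the un-normalised integrals are entire in the source. (NOT PRINTED as a display: folklore calculus about the integrand of the cited (1.73), whose locator is the tag.)
[cite: Balaban1989LargeFieldII, (1.73) p.380] -/
theorem hasDerivAt_integral_tiltWeight_smul (hρ : Integrable ρ₀ μ) (hσm : AEStronglyMeasurable σ μ)
    (hWm : AEStronglyMeasurable W μ) (hσ : ∀ᵐ z ∂μ, ‖σ z‖ ≤ s) (hW : ∀ᵐ z ∂μ, ‖W z‖ ≤ B) (hB : 0 ≤ B)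
    (hhm : AEStronglyMeasurable h μ) (hh : ∀ᵐ z ∂μ, ‖h z‖ ≤ m) (t : ℂ) :
    HasDerivAt (fun τ : ℂ => ∫ z, tiltWeight ρ₀ σ W τ z • h z ∂μ)
      (∫ z, tiltWeight ρ₀ σ W t z • (W z • h z) ∂μ) t := by
  set bound : Z → ℝ := fun z => ‖ρ₀ z‖ * (Real.exp (s + (‖t‖ + 1) * B) * (B * m)) with hbound
  have hs : ball t 1 ∈ 𝓝 t := ball_mem_nhds t zero_lt_one
  have hF_meas : ∀ᶠ τ in 𝓝 t, AEStronglyMeasurable (fun z => tiltWeight ρ₀ σ W τ z • h z) μ :=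
    Eventually.of_forall fun τ => (aestronglyMeasurable_tiltWeight hρ.1 hσm hWm τ).smul hhm
  have hF_int : Integrable (fun z => tiltWeight ρ₀ σ W t z • h z) μ :=
    integrable_tiltWeight_smul hρ hσm hWm hσ hW hhm hh t
  have hF'_meas : AEStronglyMeasurable (fun z => tiltWeight ρ₀ σ W t z • (W z • h z)) μ :=
    (aestronglyMeasurable_tiltWeight hρ.1 hσm hWm t).smul (hWm.smul hhm)
  have h_bound : ∀ᵐ z ∂μ, ∀ τ ∈ ball t 1, ‖tiltWeight ρ₀ σ W τ z • (W z • h z)‖ ≤ bound z := by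
    filter_upwards [hσ, hW, hh] with z hz hWz hhz τ hτ
    have hτ' : ‖τ‖ ≤ ‖t‖ + 1 := by
      have hd : ‖τ - t‖ < 1 := mem_ball_iff_norm.mp hτ
      calc ‖τ‖ = ‖t + (τ - t)‖ := by rw [add_sub_cancel]
        _ ≤ ‖t‖ + ‖τ - t‖ := norm_add_le _ _
        _ ≤ ‖t‖ + 1 := by linarith
    have hexp : ‖σ z + τ * W z‖ ≤ s + (‖t‖ + 1) * B := by
      have hmono : ‖τ‖ * B ≤ (‖t‖ + 1) * B := mul_le_mul_of_nonneg_right hτ' hB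
      exact (norm_add_mul_le hz hWz).trans (by linarith)
    have hWh : ‖W z • h z‖ ≤ B * m := by
      rw [norm_smul]; exact mul_le_mul hWz hhz (norm_nonneg _) ((norm_nonneg _).trans hWz)
    rw [norm_smul]
    calc ‖tiltWeight ρ₀ σ W τ z‖ * ‖W z • h z‖
        ≤ (|ρ₀ z| * Real.exp (s + (‖t‖ + 1) * B)) * (B * m) :=
          mul_le_mul (norm_weight_le hexp) hWh (norm_nonneg _) (by positivity)
      _ = bound z := by simp only [hbound, Real.norm_eq_abs]; ring
  have bound_integrable : Integrable bound μ := hρ.norm.mul_const _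
  have h_diff : ∀ᵐ z ∂μ, ∀ τ ∈ ball t 1,
      HasDerivAt (fun τ : ℂ => tiltWeight ρ₀ σ W τ z • h z) (tiltWeight ρ₀ σ W τ z • (W z • h z)) τ :=
    Eventually.of_forall fun z τ _ => hasDerivAt_tiltWeight_smul ρ₀ σ W h z τ
  exact (hasDerivAt_integral_of_dominated_loc_of_deriv_le
    (F := fun τ z => tiltWeight ρ₀ σ W τ z • h z) (F' := fun τ z => tiltWeight ρ₀ σ W τ z • (W z • h z))
    hs hF_meas hF_int hF'_meas h_bound bound_integrable h_diff).2

/-- **The normalisation is differentiable in the source** with derivative `∫ρ₀e^{σ+tW}·W dμ`, at every `t` (the scalar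
instance `h ≡ 1` of `hasDerivAt_integral_tiltWeight_smul`). (NOT PRINTED as a display: folklore calculus about the integrand of the cited (1.73), whose locator is the tag.) [cite: Balaban1989LargeFieldII, (1.73) p.380] -/
theorem hasDerivAt_integral_tiltWeight (hρ : Integrable ρ₀ μ) (hσm : AEStronglyMeasurable σ μ)
    (hWm : AEStronglyMeasurable W μ) (hσ : ∀ᵐ z ∂μ, ‖σ z‖ ≤ s) (hW : ∀ᵐ z ∂μ, ‖W z‖ ≤ B) (hB : 0 ≤ B) (t : ℂ) :
    HasDerivAt (fun τ : ℂ => ∫ z, tiltWeight ρ₀ σ W τ z ∂μ) (∫ z, tiltWeight ρ₀ σ W t z * W z ∂μ) t := by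
  have hd := hasDerivAt_integral_tiltWeight_smul (F := ℂ) (h := fun _ => (1 : ℂ)) (m := 1) hρ hσm hWm hσ hW hB
    aestronglyMeasurable_const (Eventually.of_forall fun _ => by simp) t
  simpa only [smul_eq_mul, mul_one] using hd

/-- **THE COVARIANCE IS THE t-DERIVATIVE OF THE TILTED NORMALISED EXPECTATION**: on the tilt disc `s + |t|B ≤ 1` (where the
normalisation does not vanish, (1.74)ₜ), `τ ↦ tiltedMean h τ` has complex derivative `tiltedCov h t` at `t` (quotient rule on
`(∫tiltWeight)⁻¹ • ∫tiltWeight•h`, `cov_algebra`). (NOT PRINTED as a display: folklore calculus about the normalised operation of the cited (1.75), whose locator is the tag.) [cite: Balaban1989LargeFieldII, (1.75) p.380] -/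
theorem hasDerivAt_tiltedMean (hρ : Integrable ρ₀ μ) (hρ0 : 0 ≤ᵐ[μ] ρ₀) (hP : 0 < ∫ z, ρ₀ z ∂μ)
    (hσm : AEStronglyMeasurable σ μ) (hWm : AEStronglyMeasurable W μ) (hσ : ∀ᵐ z ∂μ, ‖σ z‖ ≤ s)
    (hW : ∀ᵐ z ∂μ, ‖W z‖ ≤ B) (hhm : AEStronglyMeasurable h μ) (hh : ∀ᵐ z ∂μ, ‖h z‖ ≤ m)
    {t : ℂ} (ht : s + ‖t‖ * B ≤ 1) :
    HasDerivAt (fun τ : ℂ => tiltedMean μ ρ₀ σ W h τ) (tiltedCov μ ρ₀ σ W h t) t := by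
  have hB : 0 ≤ B := nonneg_of_ae_norm_le hP hW
  have hDd := hasDerivAt_integral_tiltWeight hρ hσm hWm hσ hW hB t
  have hNd := hasDerivAt_integral_tiltWeight_smul hρ hσm hWm hσ hW hB hhm hh t
  have hne : (∫ z, tiltWeight ρ₀ σ W t z ∂μ) ≠ 0 := integral_tiltWeight_ne_zero hρ hρ0 hσm hWm hσ hW ht hP
  have key := (hDd.inv hne).smul hNd
  have hval : tiltedCov μ ρ₀ σ W h t =
      (∫ z, tiltWeight ρ₀ σ W t z ∂μ)⁻¹ • (∫ z, tiltWeight ρ₀ σ W t z • (W z • h z) ∂μ) +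
        (-(∫ z, tiltWeight ρ₀ σ W t z * W z ∂μ) / (∫ z, tiltWeight ρ₀ σ W t z ∂μ) ^ 2) •
          (∫ z, tiltWeight ρ₀ σ W t z • h z ∂μ) := by
    simp only [tiltedCov, tiltedMean, smul_eq_mul]
    exact cov_algebra _ _ _ _
  rw [hval]
  exact key

/-- **THE COVARIANCE BOUND**: on the tilt disc, `‖tiltedCov h t‖ ≤ 2·B·e^{6(s+|t|B)}·m` — (1.75)ₜ applied to `W•h` (bound
`B·m`), to `W` (bound `B`) and to `h` (bound `m`), and `e^{3x}(1 + e^{3x}) ≤ 2e^{6x}` for `x = s + |t|B ≥ 0`. (NOT PRINTED as a display: folklore calculus about the normalised operation of the cited (1.75), whose locator is the tag.) [cite: Balaban1989LargeFieldII, (1.75) p.380] -/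
theorem norm_tiltedCov_le (hρ : Integrable ρ₀ μ) (hρ0 : 0 ≤ᵐ[μ] ρ₀) (hP : 0 < ∫ z, ρ₀ z ∂μ)
    (hσm : AEStronglyMeasurable σ μ) (hWm : AEStronglyMeasurable W μ) (hσ : ∀ᵐ z ∂μ, ‖σ z‖ ≤ s)
    (hW : ∀ᵐ z ∂μ, ‖W z‖ ≤ B) (hh : ∀ᵐ z ∂μ, ‖h z‖ ≤ m) (hm : 0 ≤ m) {t : ℂ} (ht : s + ‖t‖ * B ≤ 1) :
    ‖tiltedCov μ ρ₀ σ W h t‖ ≤ 2 * B * Real.exp (6 * (s + ‖t‖ * B)) * m := by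
  have hB : 0 ≤ B := nonneg_of_ae_norm_le hP hW
  have hs : 0 ≤ s := nonneg_of_ae_norm_le hP hσ
  set x : ℝ := s + ‖t‖ * B with hx
  have hx0 : 0 ≤ x := add_nonneg hs (mul_nonneg (norm_nonneg _) hB)
  have h1 : ‖tiltedMean μ ρ₀ σ W (fun z => W z • h z) t‖ ≤ Real.exp (3 * x) * (B * m) :=
    norm_tiltedMean_le hρ hρ0 hP hσm hWm hσ hW (ae_norm_smul_le hW hh) (mul_nonneg hB hm) ht
  have h2 : ‖tiltedMean μ ρ₀ σ W W t‖ ≤ Real.exp (3 * x) * B :=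
    norm_tiltedMean_le (F := ℂ) hρ hρ0 hP hσm hWm hσ hW hW hB ht
  have h3 : ‖tiltedMean μ ρ₀ σ W h t‖ ≤ Real.exp (3 * x) * m :=
    norm_tiltedMean_le hρ hρ0 hP hσm hWm hσ hW hh hm ht
  have hexp1 : 1 ≤ Real.exp (3 * x) := Real.one_le_exp (by positivity)
  have hexp2 : Real.exp (3 * x) * Real.exp (3 * x) = Real.exp (6 * x) := by
    rw [← Real.exp_add]; ring_nf
  calc ‖tiltedCov μ ρ₀ σ W h t‖
      ≤ ‖tiltedMean μ ρ₀ σ W (fun z => W z • h z) t‖ + ‖(tiltedMean μ ρ₀ σ W W t) • tiltedMean μ ρ₀ σ W h t‖ :=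
        norm_sub_le _ _
    _ ≤ Real.exp (3 * x) * (B * m) + (Real.exp (3 * x) * B) * (Real.exp (3 * x) * m) := by
        rw [norm_smul]
        exact add_le_add h1 (mul_le_mul h2 h3 (norm_nonneg _) (by positivity))
    _ = Real.exp (3 * x) * B * m * (1 + Real.exp (3 * x)) := by ring
    _ ≤ Real.exp (3 * x) * B * m * (Real.exp (3 * x) + Real.exp (3 * x)) :=
        mul_le_mul_of_nonneg_left (by linarith) (by positivity)
    _ = 2 * B * Real.exp (6 * x) * m := by rw [← hexp2]; ring

/-- **THE DESK STUB'S `TiltedCovarianceBound`**, restated BY NAME with the same body (desk file `N14TiltedStub.lean`): on the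
open tilt disc `s + |t|·B < 1` the map `t ↦ tiltedMean h t` is complex-differentiable with derivative the covariance, and
`‖tiltedCov h t‖ ≤ 2·B·e^{6(s+|t|B)}·m`. (NOT PRINTED as a display: folklore calculus about the normalised operation of the cited (1.75), whose locator is the tag.) [cite: Balaban1989LargeFieldII, (1.75) p.380] -/
def TiltedCovarianceBound (μ : Measure Z) (ρ₀ : Z → ℝ) (σ W : Z → ℂ) (s B : ℝ) : Prop :=
  Integrable ρ₀ μ → 0 ≤ᵐ[μ] ρ₀ → 0 < ∫ z, ρ₀ z ∂μ → AEStronglyMeasurable σ μ → AEStronglyMeasurable W μ →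
  (∀ᵐ z ∂μ, ‖σ z‖ ≤ s) → (∀ᵐ z ∂μ, ‖W z‖ ≤ B) →
  ∀ (h : Z → F) (m : ℝ) (t : ℂ), 0 ≤ m → AEStronglyMeasurable h μ → (∀ᵐ z ∂μ, ‖h z‖ ≤ m) →
    s + ‖t‖ * B < 1 →
      HasDerivAt (fun τ : ℂ => tiltedMean μ ρ₀ σ W h τ) (tiltedCov μ ρ₀ σ W h t) t ∧
      ‖tiltedCov μ ρ₀ σ W h t‖ ≤ 2 * B * Real.exp (6 * (s + ‖t‖ * B)) * m

/-- **`TiltedCovarianceBound` INHABITED** for every datum — THE FIRST NON-SUBSTITUTION ESTIMATE of the observable-attached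
(1.71)–(1.75) currency (`hasDerivAt_tiltedMean` + `norm_tiltedCov_le`; both hold on the CLOSED disc, a fortiori on the open
one). (NOT PRINTED as a display: folklore calculus about the normalised operation of the cited (1.75), whose locator is the tag.) [cite: Balaban1989LargeFieldII, (1.75) p.380] -/
theorem tiltedCovarianceBound (μ : Measure Z) (ρ₀ : Z → ℝ) (σ W : Z → ℂ) (s B : ℝ) :
    TiltedCovarianceBound (F := F) μ ρ₀ σ W s B :=
  fun hρ hρ0 hP hσm hWm hσ hW _h _m _t hm hhm hh ht =>
    ⟨hasDerivAt_tiltedMean hρ hρ0 hP hσm hWm hσ hW hhm hh ht.le,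
      norm_tiltedCov_le hρ hρ0 hP hσm hWm hσ hW hh hm ht.le⟩

/-! ## §4 Consequences: holomorphy on the open disc and the first-order size of the dressing -/

/-- **Holomorphy in the source**: `t ↦ tiltedMean h t` is `DifferentiableOn ℂ` the open tilt disc `{t | s + |t|B < 1}`. (NOT PRINTED as a display: folklore calculus about the normalised operation of the cited (1.75), whose locator is the tag.)
[cite: Balaban1989LargeFieldII, (1.75) p.380] -/
theorem differentiableOn_tiltedMean (hρ : Integrable ρ₀ μ) (hρ0 : 0 ≤ᵐ[μ] ρ₀) (hP : 0 < ∫ z, ρ₀ z ∂μ)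
    (hσm : AEStronglyMeasurable σ μ) (hWm : AEStronglyMeasurable W μ) (hσ : ∀ᵐ z ∂μ, ‖σ z‖ ≤ s)
    (hW : ∀ᵐ z ∂μ, ‖W z‖ ≤ B) (hhm : AEStronglyMeasurable h μ) (hh : ∀ᵐ z ∂μ, ‖h z‖ ≤ m) :
    DifferentiableOn ℂ (fun τ : ℂ => tiltedMean μ ρ₀ σ W h τ) {t : ℂ | s + ‖t‖ * B < 1} :=
  fun _t ht => (hasDerivAt_tiltedMean hρ hρ0 hP hσm hWm hσ hW hhm hh (le_of_lt ht)).differentiableAt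
    |>.differentiableWithinAt

/-- **FIRST-ORDER SIZE OF THE DRESSING**: on the tilt disc the dressed normalised expectation differs from the undressed one
(`t = 0`, the operation of (1.75) itself) by at most `2·B·e^{6(s+|t|B)}·m·|t|` — the mean value inequality along the closed
ball of radius `|t|` (convex; on it the derivative is the covariance, bounded by `norm_tiltedCov_le` with the monotone
constant). (NOT PRINTED as a display: folklore calculus about the normalised operation of the cited (1.75), whose locator is the tag.) [cite: Balaban1989LargeFieldII, (1.75) p.380] -/
theorem norm_tiltedMean_sub_tiltedMean_zero_le (hρ : Integrable ρ₀ μ) (hρ0 : 0 ≤ᵐ[μ] ρ₀) (hP : 0 < ∫ z, ρ₀ z ∂μ)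
    (hσm : AEStronglyMeasurable σ μ) (hWm : AEStronglyMeasurable W μ) (hσ : ∀ᵐ z ∂μ, ‖σ z‖ ≤ s)
    (hW : ∀ᵐ z ∂μ, ‖W z‖ ≤ B) (hhm : AEStronglyMeasurable h μ) (hh : ∀ᵐ z ∂μ, ‖h z‖ ≤ m) (hm : 0 ≤ m)
    {t : ℂ} (ht : s + ‖t‖ * B ≤ 1) :
    ‖tiltedMean μ ρ₀ σ W h t - tiltedMean μ ρ₀ σ W h 0‖ ≤ 2 * B * Real.exp (6 * (s + ‖t‖ * B)) * m * ‖t‖ := by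
  have hB : 0 ≤ B := nonneg_of_ae_norm_le hP hW
  -- on the closed ball of radius ‖t‖ every point τ has s + ‖τ‖B ≤ s + ‖t‖B ≤ 1
  have hderiv : ∀ τ ∈ closedBall (0 : ℂ) ‖t‖,
      HasDerivWithinAt (fun τ : ℂ => tiltedMean μ ρ₀ σ W h τ) (tiltedCov μ ρ₀ σ W h τ) (closedBall (0 : ℂ) ‖t‖) τ := by
    intro τ hτ
    have hτ' : ‖τ‖ ≤ ‖t‖ := by simpa using hτ
    have hτ1 : s + ‖τ‖ * B ≤ 1 := by
      have hmono := mul_le_mul_of_nonneg_right hτ' hB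
      linarith
    exact (hasDerivAt_tiltedMean hρ hρ0 hP hσm hWm hσ hW hhm hh hτ1).hasDerivWithinAt
  have hbound : ∀ τ ∈ closedBall (0 : ℂ) ‖t‖,
      ‖tiltedCov μ ρ₀ σ W h τ‖ ≤ 2 * B * Real.exp (6 * (s + ‖t‖ * B)) * m := by
    intro τ hτ
    have hτ' : ‖τ‖ ≤ ‖t‖ := by simpa using hτ
    have hτ1 : s + ‖τ‖ * B ≤ s + ‖t‖ * B := by
      have hmono := mul_le_mul_of_nonneg_right hτ' hB
      linarith
    refine (norm_tiltedCov_le hρ hρ0 hP hσm hWm hσ hW hh hm (hτ1.trans ht)).trans ?_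
    have hmono : Real.exp (6 * (s + ‖τ‖ * B)) ≤ Real.exp (6 * (s + ‖t‖ * B)) :=
      Real.exp_le_exp.mpr (by linarith)
    have h2B : 0 ≤ 2 * B := by positivity
    exact mul_le_mul_of_nonneg_right (mul_le_mul_of_nonneg_left hmono h2B) hm
  have key := (convex_closedBall (0 : ℂ) ‖t‖).norm_image_sub_le_of_norm_hasDerivWithin_le hderiv hbound
    (mem_closedBall_self (norm_nonneg t)) (by simp : t ∈ closedBall (0 : ℂ) ‖t‖)
  simpa using key

/-! ## §5 (v1.1, append-only) Analyticity in the source and Cauchy bounds on ALL t-derivatives — the «t-analytic with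
K-free constants» clause of the dressed (1.75) in kernel form (folklore: Cauchy's estimate on circles inside the tilt disc) -/

section Analytic

/-- On every closed ball `closedBall t₀ R` inside the closed tilt disc (`s + (|t₀| + R)·B ≤ 1`) the tilted normalised expectation is
`DiffContOnCl ℂ` the open ball: differentiable at every point of the closed ball by `hasDerivAt_tiltedMean`. (NOT PRINTED as a
display: folklore calculus about the normalised operation of the cited (1.75), whose locator is the tag.)
[cite: Balaban1989LargeFieldII, (1.75) p.380] -/
theorem diffContOnCl_tiltedMean (hρ : Integrable ρ₀ μ) (hρ0 : 0 ≤ᵐ[μ] ρ₀) (hP : 0 < ∫ z, ρ₀ z ∂μ)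
    (hσm : AEStronglyMeasurable σ μ) (hWm : AEStronglyMeasurable W μ) (hσ : ∀ᵐ z ∂μ, ‖σ z‖ ≤ s)
    (hW : ∀ᵐ z ∂μ, ‖W z‖ ≤ B) (hhm : AEStronglyMeasurable h μ) (hh : ∀ᵐ z ∂μ, ‖h z‖ ≤ m)
    {t₀ : ℂ} {R : ℝ} (hR : s + (‖t₀‖ + R) * B ≤ 1) :
    DiffContOnCl ℂ (fun τ : ℂ => tiltedMean μ ρ₀ σ W h τ) (ball t₀ R) := by
  have hB : 0 ≤ B := nonneg_of_ae_norm_le hP hW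
  have hdiff : ∀ τ ∈ closedBall t₀ R, DifferentiableAt ℂ (fun τ : ℂ => tiltedMean μ ρ₀ σ W h τ) τ := by
    intro τ hτ
    have hτ' : ‖τ‖ ≤ ‖t₀‖ + R := by
      have hd : ‖τ - t₀‖ ≤ R := mem_closedBall_iff_norm.mp hτ
      calc ‖τ‖ = ‖t₀ + (τ - t₀)‖ := by rw [add_sub_cancel]
        _ ≤ ‖t₀‖ + ‖τ - t₀‖ := norm_add_le _ _
        _ ≤ ‖t₀‖ + R := by linarith
    have hτ1 : s + ‖τ‖ * B ≤ 1 := by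
      have hmono := mul_le_mul_of_nonneg_right hτ' hB
      linarith
    exact (hasDerivAt_tiltedMean hρ hρ0 hP hσm hWm hσ hW hhm hh hτ1).differentiableAt
  refine ⟨fun τ hτ => (hdiff τ (ball_subset_closedBall hτ)).differentiableWithinAt, fun τ hτ => ?_⟩
  exact (hdiff τ (closure_ball_subset_closedBall hτ)).continuousAt.continuousWithinAt

variable [CompleteSpace F]

/-- **CAUCHY BOUNDS ON ALL SOURCE DERIVATIVES OF THE DRESSED NORMALISED EXPECTATION**: for `0 < R` with
`s + (|t₀| + R)·B ≤ 1`, `‖∂ⁿ_t E_t h |_{t₀}‖ ≤ n! · e^{3(s + (|t₀|+R)B)} · m / Rⁿ` — (1.75)ₜ on the circle of radius `R` about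
`t₀` and Cauchy's estimate (Mathlib `Complex.norm_iteratedDeriv_le_of_forall_mem_sphere_norm_le`); the constants are those of the
tilt disc only (in the cell's reading: independent of the cutoff).  (NOT PRINTED as a display: folklore calculus about the
normalised operation of the cited (1.75), whose locator is the tag.) [cite: Balaban1989LargeFieldII, (1.75) p.380] -/
theorem norm_iteratedDeriv_tiltedMean_le (hρ : Integrable ρ₀ μ) (hρ0 : 0 ≤ᵐ[μ] ρ₀) (hP : 0 < ∫ z, ρ₀ z ∂μ)
    (hσm : AEStronglyMeasurable σ μ) (hWm : AEStronglyMeasurable W μ) (hσ : ∀ᵐ z ∂μ, ‖σ z‖ ≤ s)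
    (hW : ∀ᵐ z ∂μ, ‖W z‖ ≤ B) (hhm : AEStronglyMeasurable h μ) (hh : ∀ᵐ z ∂μ, ‖h z‖ ≤ m) (hm : 0 ≤ m)
    {t₀ : ℂ} {R : ℝ} (hR0 : 0 < R) (hR : s + (‖t₀‖ + R) * B ≤ 1) (n : ℕ) :
    ‖iteratedDeriv n (fun τ : ℂ => tiltedMean μ ρ₀ σ W h τ) t₀‖
      ≤ n.factorial * (Real.exp (3 * (s + (‖t₀‖ + R) * B)) * m) / R ^ n := by
  have hB : 0 ≤ B := nonneg_of_ae_norm_le hP hW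
  refine Complex.norm_iteratedDeriv_le_of_forall_mem_sphere_norm_le n hR0
    (diffContOnCl_tiltedMean hρ hρ0 hP hσm hWm hσ hW hhm hh hR) fun z hz => ?_
  have hz' : ‖z‖ ≤ ‖t₀‖ + R := by
    have hd : ‖z - t₀‖ = R := mem_sphere_iff_norm.mp hz
    calc ‖z‖ = ‖t₀ + (z - t₀)‖ := by rw [add_sub_cancel]
      _ ≤ ‖t₀‖ + ‖z - t₀‖ := norm_add_le _ _
      _ = ‖t₀‖ + R := by rw [hd]
  have hmono : ‖z‖ * B ≤ (‖t₀‖ + R) * B := mul_le_mul_of_nonneg_right hz' hB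
  have hz1 : s + ‖z‖ * B ≤ 1 := by linarith
  refine (norm_tiltedMean_le hρ hρ0 hP hσm hWm hσ hW hh hm hz1).trans ?_
  exact mul_le_mul_of_nonneg_right (Real.exp_le_exp.mpr (by linarith)) hm

/-- **ANALYTICITY IN THE SOURCE**: the tilted normalised expectation is analytic at every point of the open tilt disc
`{t | s + |t|B < 1}` (holomorphy `differentiableOn_tiltedMean` on an open set, complete codomain).  (NOT PRINTED as a display:
folklore calculus about the normalised operation of the cited (1.75), whose locator is the tag.)
[cite: Balaban1989LargeFieldII, (1.75) p.380] -/
theorem analyticOnNhd_tiltedMean (hρ : Integrable ρ₀ μ) (hρ0 : 0 ≤ᵐ[μ] ρ₀) (hP : 0 < ∫ z, ρ₀ z ∂μ)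
    (hσm : AEStronglyMeasurable σ μ) (hWm : AEStronglyMeasurable W μ) (hσ : ∀ᵐ z ∂μ, ‖σ z‖ ≤ s)
    (hW : ∀ᵐ z ∂μ, ‖W z‖ ≤ B) (hhm : AEStronglyMeasurable h μ) (hh : ∀ᵐ z ∂μ, ‖h z‖ ≤ m) :
    AnalyticOnNhd ℂ (fun τ : ℂ => tiltedMean μ ρ₀ σ W h τ) {t : ℂ | s + ‖t‖ * B < 1} :=
  (differentiableOn_tiltedMean hρ hρ0 hP hσm hWm hσ hW hhm hh).analyticOnNhd
    (isOpen_lt (continuous_const.add (continuous_norm.mul continuous_const)) continuous_const)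

end Analytic

end Literature.MathematicalPhysics.QuantumFieldTheory.Balaban1983to89.B16Ineq175Tilted

end
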